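import Summits.PneNP.PneNP.Theorems.ChebyshevTracialDesignCrossingPlaneExp
import Summits.PneNP.PneNP.Theorems.ChebyshevTracialDesignCrossingCountTailsExplicit
import HarnessLib

/-!
# Cell pnp-psdrank, route `ChebyshevTracialDesign`: (CG_1′) IN THE CROSSING PLANE, AVERAGED OVER ALL MATCHINGS — brick 127
# (crux `TracialDecayExp20`, stmt-PneNP-19878)

Brick 127 (prover g25; MEMO-27 §4 (a): «the M-AVERAGE assembly»). Brick 126 (`crossingPlane_value_le_exp`) bounds the per-matching
value `V(M) = |PM|·Σ_U W(U,M)·ψ(|U∩H|)·C_u(U,M)²` of an `H`-symmetric tilted mask in a crossing-plane direction by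
`10⁴(1+B_v)G n⁶ e^{−a′D}` for every NON-ALIGNED matching (`βn ≤ b_M(H) ≤ (½−β)n` crossing edges, `|H| = n/2`). The design value of
the `(U,M)`-test function `F(U,M) = ψ(|U∩H|)·C_u(U,M)²` is the AVERAGE `Σ_M Σ_U W F = |PM|⁻¹·Σ_M V(M)`. The ALIGNED matchings
(`b_M(H) ≤ n/40` or `≥ n/2 − n/40`) are an exponentially small fraction by the engine's crossing-count tails
(`ChebyshevTracialDesignCrossingCountTailsExplicit.card_pmatch_crosses_le_le` / `card_pmatch_le_crosses_le`, mass `≤ 2·2^{−⌊n/40⌋}`),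
and on them the trivial bound `|V(M)| ≤ 9n²G·B_v` suffices:

* §1 `card_filter_crosses_eq_card_vBH`, **`card_reps_vB_eq_card_crosses`** — the bridge between the type count `b_M(H)` of the
  shell-law files (`reps` of the mixed vertices) and Rothvoß's `#{e ∈ M : e crosses H}` of the engine's tails.
* §2 `abs_crossingForm_le`, **`value_le_trivial`** — `|C_u(U,M)| ≤ 3n`, and `V(M) ≤ 9n²·G·B_v` for EVERY matching (the design has
  total variation `≤ B_v`; `designValue_eq_shellAvg`).
* §3 **`crossingPlane_designValue_le`** — THE M-AVERAGE: for every `a′ > 0` there is `n₀` such that for `n ≥ n₀`, every balanced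
  exact design (`2 ≤ D`, `D⁴ ≤ n`, `2D+1 ≤ T ≤ 7⌊√n⌋`), every balanced block `|H| = n/2`, every `0 ≤ ψ ≤ G`, `|λ|,|κ| ≤ 1`:
  `Σ_M Σ_U W(U,M)·ψ(|U∩H|)·C_u(U,M)² ≤ 10⁴·(1+B_v)·G·n⁶·(e^{−a′D} + 2^{−⌊n/40⌋})`.
READING: the design value of every `H`-symmetric mask tilted by a squared crossing-plane containment form — a genuine (non-junta,
non-tight) psd test function of dimension `≍ n²` — is `≤ poly(n)·(e^{−a′D} + 2^{−n/40})`: (CG_1′) for this class, unconditionally,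
ASYMPTOTIC ONLY. WHAT THIS FILE DOES NOT DO: directions outside the crossing plane ((O3)), unbalanced blocks, general (spread)
strategies — nothing on `TracialDecayExp20` itself, psd rank of P_PM(K_n), or P vs NP.
[cite: Rothvoss2017, §2 (PDF pp. 5–6)] [cite: RollinRoss2010, §4.1 Thm 4.2] [cite: Durrett2019, §2.7]
Stature: support/instrument (kernel lane, no defs, axioms standard). Supports stmt-PneNP-19878.
-/

set_option linter.dupNamespace false -- `Summit.PneNP.PneNP.…`: summit = sub-problem (D-0017)

noncomputable section

namespace Summit.PneNP.PneNP.Theorems.ChebyshevTracialDesignCrossingPlaneAverage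

open Finset Literature.Barriers.PneNP Literature.Combinatorics.Optimization
open Literature.Combinatorics.Optimization.ShellStep
open Literature.Combinatorics.SimpleGraph.CycleSpace
open Summit.PneNP.PneNP.Theorems.ChebyshevTracialDesignShellOperatorForm (designValue_eq_shellAvg)
open Summit.PneNP.PneNP.Theorems.ChebyshevTracialDesignCrossingPlaneExp (crossingPlane_value_le_exp)
open Summit.PneNP.PneNP.Theorems.ChebyshevTracialDesignCrossingCountTailsExplicit
  (card_pmatch_crosses_le_le card_pmatch_le_crosses_le)

variable {n : ℕ}

/-! ### §1 The bridge: `reps` of the mixed vertices = edges crossing `H` -/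

/-- The edges of `M` crossing `H` correspond to the `H`-endpoints of the mixed edges, `v ↦ {v, πv}`:
`#{e ∈ M : e crosses H} = |vBH_π(univ, H)|`. [cite: Rothvoss2017, §2 (PDF p. 5)] -/
theorem card_filter_crosses_eq_card_vBH (M : PMatch n) (H : Finset (Fin n)) :
    (M.1.filter (Crosses H)).card = (vBH M.2.partner univ H).card := by
  classical
  symm
  refine card_bij (fun v _ => s(v, M.2.partner v)) ?_ ?_ ?_
  · intro v hv
    obtain ⟨-, hvH, hπv⟩ := mem_vBH.1 hv
    exact mem_filter.2 ⟨M.2.mk_partner_mem v, (crosses_mk H v _).2 (Or.inl ⟨hvH, hπv⟩)⟩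
  · intro v hv w hw h
    obtain ⟨-, hvH, _⟩ := mem_vBH.1 hv
    obtain ⟨-, _, hπw⟩ := mem_vBH.1 hw
    rcases Sym2.eq_iff.1 h with ⟨h1, _⟩ | ⟨h1, _⟩
    · exact h1
    · exact absurd (h1 ▸ hvH) hπw
  · intro e he
    obtain ⟨heM, hcr⟩ := mem_filter.1 he
    induction e using Sym2.ind with
    | h x y =>
      rcases (crosses_mk H x y).1 hcr with ⟨hx, hy⟩ | ⟨hx, hy⟩
      · have hyx : y = M.2.partner x := M.2.eq_partner_of_mem heM
        exact ⟨x, mem_vBH.2 ⟨mem_univ _, hx, hyx ▸ hy⟩, by rw [hyx]⟩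
      · have hxy : x = M.2.partner y := M.2.eq_partner_of_mem (by rw [Sym2.eq_swap]; exact heM)
        exact ⟨y, mem_vBH.2 ⟨mem_univ _, hy, hxy ▸ hx⟩, by rw [← hxy, Sym2.eq_swap]⟩

/-- **The bridge.** The number `b_M(H)` of mixed EDGES of `M` (as the representative count of the shell-law files) is the
number of edges of `M` crossing `H`. [cite: Rothvoss2017, §2 (PDF p. 5)] -/
theorem card_reps_vB_eq_card_crosses (M : PMatch n) (H : Finset (Fin n)) :
    (reps M.2.partner (vBH M.2.partner univ H ∪ vBN M.2.partner univ H)).card = (M.1.filter (Crosses H)).card := by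
  have hπ : ∀ v, M.2.partner (M.2.partner v) = v := partner_partner M
  have hπ' : ∀ v, M.2.partner v ≠ v := partner_ne M
  have hst : ∀ v ∈ (univ : Finset (Fin n)), M.2.partner v ∈ univ := fun v _ => mem_univ _
  have hB := two_mul_card_reps hπ hπ' (vB_stable hπ univ H hst)
  have hBB := card_vBH_eq_card_vBN hπ hst H
  have hdisj : Disjoint (vBH M.2.partner univ H) (vBN M.2.partner univ H) :=
    disjoint_left.2 fun v hv hv' => (mem_vBN.1 hv').2.1 (mem_vBH.1 hv).2.1
  rw [card_union_of_disjoint hdisj, ← hBB, ← card_filter_crosses_eq_card_vBH M H] at hB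
  omega

/-! ### §2 The trivial per-matching bound -/

/-- The crossing-plane containment form is bounded: `|Σ_p (λ([p,πp ∈ H] − [p,πp ∉ H]) + (λ+κ))·x_p x_{πp}| ≤ 3n` for
`|λ|, |κ| ≤ 1`. [cite: Rothvoss2017, §2 (PDF p. 6)] -/
theorem abs_crossingForm_le (M : PMatch n) (H U : Finset (Fin n)) {lam kap : ℝ} (hlam : |lam| ≤ 1) (hkap : |kap| ≤ 1) :
    |∑ p : Fin n, (lam * ((if (p ∈ H ∧ M.2.partner p ∈ H) then (1 : ℝ) else 0) -
        (if (p ∉ H ∧ M.2.partner p ∉ H) then (1 : ℝ) else 0)) + (lam + kap)) *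
        ((if p ∈ U then (1 : ℝ) else 0) * (if M.2.partner p ∈ U then (1 : ℝ) else 0))| ≤ 3 * n := by
  refine (abs_sum_le_sum_abs _ _).trans ?_
  have hterm : ∀ p : Fin n, |(lam * ((if (p ∈ H ∧ M.2.partner p ∈ H) then (1 : ℝ) else 0) -
      (if (p ∉ H ∧ M.2.partner p ∉ H) then (1 : ℝ) else 0)) + (lam + kap)) *
      ((if p ∈ U then (1 : ℝ) else 0) * (if M.2.partner p ∈ U then (1 : ℝ) else 0))| ≤ 3 := by
    intro p
    rw [abs_mul]
    have h1 : |lam * ((if (p ∈ H ∧ M.2.partner p ∈ H) then (1 : ℝ) else 0) -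
        (if (p ∉ H ∧ M.2.partner p ∉ H) then (1 : ℝ) else 0)) + (lam + kap)| ≤ 3 := by
      have hl := abs_le.1 hlam; have hk := abs_le.1 hkap
      rw [abs_le]; constructor <;> split_ifs <;> nlinarith
    have h2 : |(if p ∈ U then (1 : ℝ) else 0) * (if M.2.partner p ∈ U then (1 : ℝ) else 0)| ≤ 1 := by
      rw [abs_le]; constructor <;> split_ifs <;> norm_num
    calc _ ≤ 3 * 1 := mul_le_mul h1 h2 (abs_nonneg _) (by norm_num)
      _ = 3 := by norm_num
  calc _ ≤ ∑ _p : Fin n, (3 : ℝ) := sum_le_sum fun p _ => hterm p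
    _ = 3 * n := by rw [sum_const, card_univ, Fintype.card_fin, nsmul_eq_mul]; ring

/-- **Trivial per-matching bound**: for every matching `M`, block `H`, `|ψ| ≤ G` on `[0,t]` and `|λ|,|κ| ≤ 1`,
`|PM|·Σ_U W(U,M)·ψ(|U∩H|)·C_u(U,M)² ≤ 9n²·G·B_v` (total variation of the design). [cite: Rothvoss2017, §2 (PDF p. 6)] -/
theorem value_le_trivial {t T D : ℕ} {Bv : ℝ} {C : Finset ℕ} {w : ℕ → ℝ} (hdes : IsExactDesign n t T D Bv C w)
    (M : PMatch n) (H : Finset (Fin n)) (ψ : ℤ → ℝ) {G : ℝ} (hG0 : 0 ≤ G)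
    (hG : ∀ x ∈ Icc (0 : ℤ) ((t : ℕ) : ℤ), |ψ x| ≤ G) {lam kap : ℝ} (hlam : |lam| ≤ 1) (hkap : |kap| ≤ 1) :
    (Fintype.card (PMatch n) : ℝ) * ∑ U : OddSet n, levelWeight n t C w U M *
        (ψ ((U.1 ∩ H).card : ℤ) *
          (∑ p : Fin n, (lam * ((if (p ∈ H ∧ M.2.partner p ∈ H) then (1 : ℝ) else 0) -
              (if (p ∉ H ∧ M.2.partner p ∉ H) then (1 : ℝ) else 0)) + (lam + kap)) *
            ((if p ∈ U.1 then (1 : ℝ) else 0) * (if M.2.partner p ∈ U.1 then (1 : ℝ) else 0))) ^ 2) ≤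
      9 * (n : ℝ) ^ 2 * G * Bv := by
  have hPM : (Fintype.card (PMatch n) : ℝ) ≠ 0 := by
    have : 0 < Fintype.card (PMatch n) := Fintype.card_pos_iff.2 ⟨M⟩
    positivity
  rw [designValue_eq_shellAvg t hdes.1 C w M (fun U' => ψ ((U' ∩ H).card : ℤ) *
      (∑ p : Fin n, (lam * ((if (p ∈ H ∧ M.2.partner p ∈ H) then (1 : ℝ) else 0) -
          (if (p ∉ H ∧ M.2.partner p ∉ H) then (1 : ℝ) else 0)) + (lam + kap)) *
        ((if p ∈ U' then (1 : ℝ) else 0) * (if M.2.partner p ∈ U' then (1 : ℝ) else 0))) ^ 2),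
    ← mul_assoc, mul_inv_cancel₀ hPM, one_mul]
  -- each shell average is at most `9n²G`
  have havg : ∀ c ∈ C, |(∑ U' ∈ shell M.2.partner t c, ψ ((U' ∩ H).card : ℤ) *
      (∑ p : Fin n, (lam * ((if (p ∈ H ∧ M.2.partner p ∈ H) then (1 : ℝ) else 0) -
          (if (p ∉ H ∧ M.2.partner p ∉ H) then (1 : ℝ) else 0)) + (lam + kap)) *
        ((if p ∈ U' then (1 : ℝ) else 0) * (if M.2.partner p ∈ U' then (1 : ℝ) else 0))) ^ 2) /
      ((shell M.2.partner t c).card : ℝ)| ≤ 9 * (n : ℝ) ^ 2 * G := by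
    intro c _
    have hb : ∀ U' ∈ shell M.2.partner t c, |ψ ((U' ∩ H).card : ℤ) *
        (∑ p : Fin n, (lam * ((if (p ∈ H ∧ M.2.partner p ∈ H) then (1 : ℝ) else 0) -
            (if (p ∉ H ∧ M.2.partner p ∉ H) then (1 : ℝ) else 0)) + (lam + kap)) *
          ((if p ∈ U' then (1 : ℝ) else 0) * (if M.2.partner p ∈ U' then (1 : ℝ) else 0))) ^ 2| ≤
        9 * (n : ℝ) ^ 2 * G := by
      intro U' hU'
      have hUt : U'.card = t := ((mem_shell).1 hU').1
      have hx : ((U' ∩ H).card : ℤ) ∈ Icc (0 : ℤ) ((t : ℕ) : ℤ) := by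
        rw [mem_Icc]; refine ⟨by positivity, ?_⟩
        have := card_le_card (inter_subset_left (s₁ := U') (s₂ := H))
        rw [hUt] at this; exact_mod_cast this
      have h1 := hG _ hx
      have h2 := abs_crossingForm_le M H U' hlam hkap
      rw [abs_mul, abs_pow]
      have h3 : |∑ p : Fin n, (lam * ((if (p ∈ H ∧ M.2.partner p ∈ H) then (1 : ℝ) else 0) -
          (if (p ∉ H ∧ M.2.partner p ∉ H) then (1 : ℝ) else 0)) + (lam + kap)) *
          ((if p ∈ U' then (1 : ℝ) else 0) * (if M.2.partner p ∈ U' then (1 : ℝ) else 0))| ^ 2 ≤ (3 * n) ^ 2 :=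
        pow_le_pow_left₀ (abs_nonneg _) h2 2
      nlinarith [abs_nonneg (ψ ((U' ∩ H).card : ℤ)), h1, h3, hG0]
    by_cases h0 : (shell M.2.partner t c).card = 0
    · rw [h0, Nat.cast_zero, div_zero, abs_zero]; positivity
    have hpos : (0 : ℝ) < (shell M.2.partner t c).card := by positivity
    rw [abs_div, abs_of_pos hpos, div_le_iff₀ hpos]
    refine (abs_sum_le_sum_abs _ _).trans ?_
    calc _ ≤ ∑ _U' ∈ shell M.2.partner t c, 9 * (n : ℝ) ^ 2 * G := sum_le_sum hb
      _ = 9 * (n : ℝ) ^ 2 * G * (shell M.2.partner t c).card := by rw [sum_const, nsmul_eq_mul]; ring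
  have hvar : ∑ c ∈ C, |w c| ≤ Bv := hdes.2.2.2.2.2.2
  refine (le_abs_self _).trans ((abs_sum_le_sum_abs _ _).trans ?_)
  calc _ ≤ ∑ c ∈ C, |w c| * (9 * (n : ℝ) ^ 2 * G) := by
        refine sum_le_sum fun c hc => ?_
        rw [abs_mul]
        exact mul_le_mul_of_nonneg_left (havg c hc) (abs_nonneg _)
    _ = (∑ c ∈ C, |w c|) * (9 * (n : ℝ) ^ 2 * G) := by rw [sum_mul]
    _ ≤ Bv * (9 * (n : ℝ) ^ 2 * G) := mul_le_mul_of_nonneg_right hvar (by positivity)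
    _ = 9 * (n : ℝ) ^ 2 * G * Bv := by ring

/-! ### §3 The average over all matchings -/

/-- **(CG_1′) IN THE CROSSING PLANE, AVERAGED OVER ALL MATCHINGS (brick 127).** For every `a′ > 0` there is `n₀` such that for
all `n ≥ n₀`: for every balanced exact design `(n,t,T,D,B_v,C,w)` with `2 ≤ D`, `D⁴ ≤ n`, `2D+1 ≤ T ≤ 7⌊√n⌋`, every balanced block
`|H| = n/2`, every `0 ≤ ψ ≤ G` on `[0,t]` and `|λ|,|κ| ≤ 1`, the DESIGN VALUE of the tilted mask `F(U,M) = ψ(|U∩H|)·C_u(U,M)²` obeys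
`Σ_M Σ_U W(U,M)·F(U,M) ≤ 10⁴·(1+B_v)·G·n⁶·(e^{−a′D} + 2^{−⌊n/40⌋})` (non-aligned matchings by brick 126 with `β = 1/40`, aligned
ones by the engine's `2^{−⌊n/40⌋}` crossing-count tails and the trivial bound). [cite: Rothvoss2017, §2 (PDF pp. 5–6)]
[cite: RollinRoss2010, §4.1 Thm 4.2] [cite: Durrett2019, §2.7] -/
theorem crossingPlane_designValue_le {a' : ℝ} (ha' : 0 < a') :
    ∃ n₀ : ℕ, ∀ n : ℕ, n₀ ≤ n → ∀ {t T D : ℕ} {Bv : ℝ} {C : Finset ℕ} {w : ℕ → ℝ},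
    IsExactDesign n t T D Bv C w → 2 * D + 1 ≤ T → n ≤ 4 * t → 2 ≤ D → D ^ 4 ≤ n → T ≤ 7 * Nat.sqrt n →
    ∀ (H : Finset (Fin n)), 2 * H.card = n →
    ∀ (ψ : ℤ → ℝ) {G : ℝ}, 0 ≤ G → (∀ x ∈ Icc (0 : ℤ) ((t : ℕ) : ℤ), |ψ x| ≤ G) →
    (∀ x ∈ Icc (0 : ℤ) ((t : ℕ) : ℤ), 0 ≤ ψ x) → ∀ (lam kap : ℝ), |lam| ≤ 1 → |kap| ≤ 1 →
    ∑ M : PMatch n, ∑ U : OddSet n, levelWeight n t C w U M *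
        (ψ ((U.1 ∩ H).card : ℤ) *
          (∑ p : Fin n, (lam * ((if (p ∈ H ∧ M.2.partner p ∈ H) then (1 : ℝ) else 0) -
              (if (p ∉ H ∧ M.2.partner p ∉ H) then (1 : ℝ) else 0)) + (lam + kap)) *
            ((if p ∈ U.1 then (1 : ℝ) else 0) * (if M.2.partner p ∈ U.1 then (1 : ℝ) else 0))) ^ 2) ≤
      10 ^ 4 * (1 + Bv) * G * (n : ℝ) ^ 6 * (Real.exp (-(a' * D)) + (1 / 2 : ℝ) ^ (n / 40)) := by
  obtain ⟨n₁, h126⟩ := crossingPlane_value_le_exp (β := 1 / 40) (a' := a') (by norm_num) ha'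
  refine ⟨max n₁ 80, ?_⟩
  intro n hn t T D Bv C w hdes hDT hbal hD2 hD4 hT7 H hH ψ G hG0 hG hψ0 lam kap hlam hkap
  have hn₁ : n₁ ≤ n := le_trans (le_max_left _ _) hn
  have hn80 : 80 ≤ n := le_trans (le_max_right _ _) hn
  have hBv : 0 ≤ Bv := le_trans (sum_nonneg fun c _ => abs_nonneg _) hdes.2.2.2.2.2.2
  -- abbreviations: the per-matching value `V`, the bounds `B₁`, `B₂`, the threshold `a₀`
  set V : PMatch n → ℝ := fun M => (Fintype.card (PMatch n) : ℝ) * ∑ U : OddSet n, levelWeight n t C w U M *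
        (ψ ((U.1 ∩ H).card : ℤ) *
          (∑ p : Fin n, (lam * ((if (p ∈ H ∧ M.2.partner p ∈ H) then (1 : ℝ) else 0) -
              (if (p ∉ H ∧ M.2.partner p ∉ H) then (1 : ℝ) else 0)) + (lam + kap)) *
            ((if p ∈ U.1 then (1 : ℝ) else 0) * (if M.2.partner p ∈ U.1 then (1 : ℝ) else 0))) ^ 2) with hVdef
  obtain ⟨B₁, hB₁⟩ : ∃ e : ℝ, e = 10 ^ 4 * (1 + Bv) * G * (n : ℝ) ^ 6 * Real.exp (-(a' * D)) := ⟨_, rfl⟩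
  obtain ⟨B₂, hB₂⟩ : ∃ e : ℝ, e = 9 * (n : ℝ) ^ 2 * G * Bv := ⟨_, rfl⟩
  have hB₁0 : 0 ≤ B₁ := by rw [hB₁]; positivity
  have hB₂0 : 0 ≤ B₂ := by rw [hB₂]; positivity
  obtain ⟨a₀, ha₀⟩ : ∃ a : ℕ, a = n / 40 := ⟨_, rfl⟩
  -- the good matchings
  set good : Finset (PMatch n) := univ.filter fun M => a₀ < (M.1.filter (Crosses H)).card ∧
    (M.1.filter (Crosses H)).card + a₀ < H.card with hgood
  have hgoodV : ∀ M ∈ good, V M ≤ B₁ := by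
    intro M hM
    obtain ⟨h1, h2⟩ := (mem_filter.1 hM).2
    rw [← card_reps_vB_eq_card_crosses M H] at h1 h2
    have hlo : (1 / 40 : ℝ) * n ≤ (reps M.2.partner (vBH M.2.partner univ H ∪ vBN M.2.partner univ H)).card := by
      have : ((a₀ + 1 : ℕ) : ℝ) ≤ (reps M.2.partner (vBH M.2.partner univ H ∪ vBN M.2.partner univ H)).card := by
        exact_mod_cast h1
      have ha : (n : ℝ) ≤ 40 * ((a₀ : ℝ) + 1) := by
        have : n < 40 * (a₀ + 1) := by omega
        exact_mod_cast this.le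
      push_cast at this; linarith
    have hhi : ((reps M.2.partner (vBH M.2.partner univ H ∪ vBN M.2.partner univ H)).card : ℝ) ≤ (1 / 2 - 1 / 40) * n := by
      have : (((reps M.2.partner (vBH M.2.partner univ H ∪ vBN M.2.partner univ H)).card + a₀ + 1 : ℕ) : ℝ) ≤
          H.card := by exact_mod_cast h2
      have hHr : (H.card : ℝ) = (n : ℝ) / 2 := by
        have : ((2 * H.card : ℕ) : ℝ) = n := by exact_mod_cast hH
        push_cast at this; linarith
      have ha : (n : ℝ) ≤ 40 * ((a₀ : ℝ) + 1) := by
        have : n < 40 * (a₀ + 1) := by omega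
        exact_mod_cast this.le
      push_cast at this; linarith
    rw [hB₁]
    exact h126 n hn₁ hdes hDT hbal hD2 hD4 hT7 M H hH hlo hhi ψ hG0 hG hψ0 lam kap hlam hkap
  -- every matching
  have hallV : ∀ M, V M ≤ B₂ := fun M => by rw [hB₂]; exact value_le_trivial hdes M H ψ hG0 hG hlam hkap
  -- the bad matchings are few
  have hHc : 9 * a₀ + 1 ≤ H.card ∧ 9 * a₀ + 1 ≤ n - H.card ∧ n - H.card = H.card ∧ 9 * (a₀ + 1) ≤ H.card := by omega
  have hbad : (((univ.filter fun M : PMatch n => ¬ (a₀ < (M.1.filter (Crosses H)).card ∧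
      (M.1.filter (Crosses H)).card + a₀ < H.card)).card : ℕ) : ℝ) ≤
      2 * (1 / 2 : ℝ) ^ a₀ * (Fintype.card (PMatch n) : ℝ) := by
    have hsub : (univ.filter fun M : PMatch n => ¬ (a₀ < (M.1.filter (Crosses H)).card ∧
        (M.1.filter (Crosses H)).card + a₀ < H.card)) ⊆
        (univ.filter fun M : PMatch n => (M.1.filter (Crosses H)).card ≤ a₀) ∪
        (univ.filter fun M : PMatch n => H.card ≤ (M.1.filter (Crosses H)).card + a₀) := by
      intro M hM
      rw [mem_filter] at hM
      rw [mem_union, mem_filter, mem_filter]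
      by_cases h : (M.1.filter (Crosses H)).card ≤ a₀
      · exact Or.inl ⟨mem_univ _, h⟩
      · right; refine ⟨mem_univ _, ?_⟩
        by_contra h'
        exact hM.2 ⟨by omega, by omega⟩
    have h1 := card_pmatch_crosses_le_le H hHc.1 hHc.2.1
    have h2 := card_pmatch_le_crosses_le H hHc.2.2.1 hHc.2.2.2
    have h3 := (card_le_card hsub).trans (card_union_le _ _)
    have h3' : (((univ.filter fun M : PMatch n => ¬ (a₀ < (M.1.filter (Crosses H)).card ∧
        (M.1.filter (Crosses H)).card + a₀ < H.card)).card : ℕ) : ℝ) ≤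
        (((univ.filter fun M : PMatch n => (M.1.filter (Crosses H)).card ≤ a₀).card : ℕ) : ℝ) +
        (((univ.filter fun M : PMatch n => H.card ≤ (M.1.filter (Crosses H)).card + a₀).card : ℕ) : ℝ) := by
      exact_mod_cast h3
    linarith
  -- the average
  have hPMpos : ∀ M : PMatch n, (0 : ℝ) < Fintype.card (PMatch n) := fun M => by
    have : 0 < Fintype.card (PMatch n) := Fintype.card_pos_iff.2 ⟨M⟩
    exact_mod_cast this
  have hsumV : ∑ M : PMatch n, ∑ U : OddSet n, levelWeight n t C w U M *
        (ψ ((U.1 ∩ H).card : ℤ) *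
          (∑ p : Fin n, (lam * ((if (p ∈ H ∧ M.2.partner p ∈ H) then (1 : ℝ) else 0) -
              (if (p ∉ H ∧ M.2.partner p ∉ H) then (1 : ℝ) else 0)) + (lam + kap)) *
            ((if p ∈ U.1 then (1 : ℝ) else 0) * (if M.2.partner p ∈ U.1 then (1 : ℝ) else 0))) ^ 2) =
      ∑ M : PMatch n, (Fintype.card (PMatch n) : ℝ)⁻¹ * V M := by
    refine sum_congr rfl fun M _ => ?_
    rw [hVdef]
    simp only []
    rw [← mul_assoc, inv_mul_cancel₀ (hPMpos M).ne', one_mul]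
  rw [hsumV, ← mul_sum, ← sum_filter_add_sum_filter_not univ (fun M : PMatch n =>
    a₀ < (M.1.filter (Crosses H)).card ∧ (M.1.filter (Crosses H)).card + a₀ < H.card)]
  have hgood_sum : ∑ M ∈ good, V M ≤ (good.card : ℝ) * B₁ := by
    rw [← nsmul_eq_mul, ← sum_const]; exact sum_le_sum hgoodV
  have hbad_sum : ∑ M ∈ univ.filter (fun M : PMatch n => ¬ (a₀ < (M.1.filter (Crosses H)).card ∧
      (M.1.filter (Crosses H)).card + a₀ < H.card)), V M ≤
      ((univ.filter fun M : PMatch n => ¬ (a₀ < (M.1.filter (Crosses H)).card ∧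
        (M.1.filter (Crosses H)).card + a₀ < H.card)).card : ℝ) * B₂ := by
    rw [← nsmul_eq_mul, ← sum_const]; exact sum_le_sum fun M _ => hallV M
  have hgood_card : (good.card : ℝ) ≤ Fintype.card (PMatch n) := by
    exact_mod_cast card_le_univ good
  -- if there is no matching the sum is empty
  by_cases hPM : Fintype.card (PMatch n) = 0
  · have : IsEmpty (PMatch n) := Fintype.card_eq_zero_iff.1 hPM
    simp only [univ_eq_empty, filter_empty, sum_empty, add_zero, mul_zero]
    positivity
  have hPMr : (0 : ℝ) < Fintype.card (PMatch n) := by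
    have : 0 < Fintype.card (PMatch n) := Nat.pos_of_ne_zero hPM
    exact_mod_cast this
  rw [← hgood]
  calc (Fintype.card (PMatch n) : ℝ)⁻¹ * (∑ M ∈ good, V M +
        ∑ M ∈ univ.filter (fun M : PMatch n => ¬ (a₀ < (M.1.filter (Crosses H)).card ∧
          (M.1.filter (Crosses H)).card + a₀ < H.card)), V M)
      ≤ (Fintype.card (PMatch n) : ℝ)⁻¹ * ((Fintype.card (PMatch n) : ℝ) * B₁ +
          (2 * (1 / 2 : ℝ) ^ a₀ * (Fintype.card (PMatch n) : ℝ)) * B₂) := by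
        refine mul_le_mul_of_nonneg_left ?_ (by positivity)
        nlinarith [hgood_sum, hbad_sum, hgood_card, hbad, hB₁0, hB₂0]
    _ = B₁ + 2 * (1 / 2 : ℝ) ^ a₀ * B₂ := by field_simp
    _ ≤ 10 ^ 4 * (1 + Bv) * G * (n : ℝ) ^ 6 * (Real.exp (-(a' * D)) + (1 / 2 : ℝ) ^ (n / 40)) := by
        rw [hB₁, hB₂, ha₀, mul_add]
        have hn1 : (1 : ℝ) ≤ n := by exact_mod_cast (show 1 ≤ n by omega)
        have hn26 : (n : ℝ) ^ 2 ≤ (n : ℝ) ^ 6 := pow_le_pow_right₀ hn1 (by norm_num)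
        have hp : (0 : ℝ) ≤ (1 / 2 : ℝ) ^ (n / 40) := by positivity
        have : 2 * (1 / 2 : ℝ) ^ (n / 40) * (9 * (n : ℝ) ^ 2 * G * Bv) ≤
            10 ^ 4 * (1 + Bv) * G * (n : ℝ) ^ 6 * (1 / 2 : ℝ) ^ (n / 40) := by
          have h18 : 18 * ((n : ℝ) ^ 2 * G * Bv) ≤ 10 ^ 4 * ((1 + Bv) * G * (n : ℝ) ^ 6) := by
            nlinarith [mul_nonneg hG0 hBv, mul_le_mul_of_nonneg_left hn26 (mul_nonneg hG0 hBv),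
              mul_nonneg hG0 (pow_nonneg (by linarith : (0:ℝ) ≤ n) 6)]
          nlinarith [mul_le_mul_of_nonneg_left h18 hp]
        linarith

/-! ### §4 In the crux's own parameters: `T = Tq n`, `D = dq n`, variation `20` -/

/-- `dq n ^ 4 ≤ n`, `2 ≤ dq n` for `n ≥ 16`, `2·dq n + 1 ≤ Tq n`, `Tq n ≤ 7⌊√n⌋` for `n ≥ 1`.
[cite: CoppersmithRivlin1992, Thm. (p. 970)] -/
theorem dq_Tq_facts {n : ℕ} (hn : 16 ≤ n) : dq n ^ 4 ≤ n ∧ 2 ≤ dq n ∧ 2 * dq n + 1 ≤ Tq n ∧ Tq n ≤ 7 * Nat.sqrt n := by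
  have h1 : Nat.sqrt n * Nat.sqrt n ≤ n := Nat.sqrt_le n
  have h2 : dq n * dq n ≤ Nat.sqrt n := Nat.sqrt_le (Nat.sqrt n)
  have h3 : 4 ≤ Nat.sqrt n := Nat.le_sqrt.2 (by omega)
  have h4 : 2 ≤ dq n := Nat.le_sqrt.2 (by unfold dq at *; omega)
  have h5 : dq n ≤ Nat.sqrt n := (dq n).le_mul_self.trans h2 |>.trans le_rfl
  refine ⟨?_, h4, ?_, ?_⟩
  · calc dq n ^ 4 = (dq n * dq n) * (dq n * dq n) := by ring
      _ ≤ Nat.sqrt n * Nat.sqrt n := Nat.mul_le_mul h2 h2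
      _ ≤ n := h1
  · unfold Tq; omega
  · unfold Tq; omega

/-- **Brick 127 in the crux's vocabulary.** For every `a′ > 0` there is `n₀` such that for all `n ≥ n₀`, every BALANCED
exact design of the crux's shape (`IsBalancedDesign n t (Tq n) (dq n) 20 C w`), every balanced block `|H| = n/2`, every
`0 ≤ ψ ≤ G` on `[0,t]` and `|λ|,|κ| ≤ 1`:
`Σ_M Σ_U W(U,M)·ψ(|U∩H|)·C_u(U,M)² ≤ 21·10⁴·G·n⁶·(e^{−a′·dq n} + 2^{−⌊n/40⌋})` — the design value of every `H`-symmetric mask tilted by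
a squared crossing-plane containment form against the weight `levelWeight n t C w` of `TracialDecayExp20`. [cite: Rothvoss2017, §2 (PDF p. 6)] -/
theorem crossingPlane_designValue_le_chebyshev {a' : ℝ} (ha' : 0 < a') :
    ∃ n₀ : ℕ, ∀ n : ℕ, n₀ ≤ n → ∀ {t : ℕ} {C : Finset ℕ} {w : ℕ → ℝ},
    IsBalancedDesign n t (Tq n) (dq n) 20 C w →
    ∀ (H : Finset (Fin n)), 2 * H.card = n →
    ∀ (ψ : ℤ → ℝ) {G : ℝ}, 0 ≤ G → (∀ x ∈ Icc (0 : ℤ) ((t : ℕ) : ℤ), |ψ x| ≤ G) →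
    (∀ x ∈ Icc (0 : ℤ) ((t : ℕ) : ℤ), 0 ≤ ψ x) → ∀ (lam kap : ℝ), |lam| ≤ 1 → |kap| ≤ 1 →
    ∑ M : PMatch n, ∑ U : OddSet n, levelWeight n t C w U M *
        (ψ ((U.1 ∩ H).card : ℤ) *
          (∑ p : Fin n, (lam * ((if (p ∈ H ∧ M.2.partner p ∈ H) then (1 : ℝ) else 0) -
              (if (p ∉ H ∧ M.2.partner p ∉ H) then (1 : ℝ) else 0)) + (lam + kap)) *
            ((if p ∈ U.1 then (1 : ℝ) else 0) * (if M.2.partner p ∈ U.1 then (1 : ℝ) else 0))) ^ 2) ≤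
      21 * 10 ^ 4 * G * (n : ℝ) ^ 6 * (Real.exp (-(a' * dq n)) + (1 / 2 : ℝ) ^ (n / 40)) := by
  obtain ⟨n₁, h127⟩ := crossingPlane_designValue_le ha'
  refine ⟨max n₁ 16, ?_⟩
  intro n hn t C w hdes H hH ψ G hG0 hG hψ0 lam kap hlam hkap
  obtain ⟨h1, h2, h3, h4⟩ := dq_Tq_facts (le_trans (le_max_right _ _) hn)
  have h := h127 n (le_trans (le_max_left _ _) hn) hdes.1 h3 hdes.2 h2 h1 h4 H hH ψ hG0 hG hψ0 lam kap hlam hkap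
  refine h.trans (le_of_eq ?_)
  ring

end Summit.PneNP.PneNP.Theorems.ChebyshevTracialDesignCrossingPlaneAverage

end
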